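import Summits.Schanuel.Schanuel.Theorems.DiophantineDichotomyApproximationPropertyDefs
import Literature.NumberTheory.Transcendental.QuadraticRelationsLogarithmsSec3Thm31
import Literature.NumberTheory.Transcendental.PhilipponCriterionProjDist
import Literature.NumberTheory.DiophantineApproximation.ApproximationByAlgebraicNumbersProofs
import Mathlib.NumberTheory.Height.NumberField
import HarnessLib

/-!
# Stub `philipponAP2_one` of line `orbit-interpolation-determinant` (stmt-Schanuel-6117)

Route `DiophantineDichotomy`, crux
`Summit.Schanuel.Schanuel.Theses.DiophantineDichotomy.ApproximationProperty`, line
`orbit-interpolation-determinant` (vocabulary in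
`Theorems/DiophantineDichotomyApproximationPropertyDefs.lean`). Philippon's PRINTED Approximation
Property 2 (LNM 1752, Ch. 4 §4 p. 61) in dimension `n = 1`, rendered with Nesterenko's projective
distance `projDist` on `ℂ²` and Mathlib's `K`-relative Weil height `Height.logHeight`: there is an
absolute constant `c ≥ 1` such that for every non-zero `x ∈ ℂ²`, all `Δ ≥ c` and `H ≥ c log(Δ + 1)`
some point `α ∈ K² ∖ 0` over a number field `K`, `σ : K → ℂ`, has `[K:ℚ] ≤ cΔ`, `h_K(α) ≤ c H` and
`‖x − σ(α)‖ ≤ exp(−(Δ h_K(α) + H [K:ℚ])/c)`. In print this case is a theorem (Laurent–Roy 1999,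
Diaz 1997); here it is read off the tree's proved `Bugeaud2004_thm_8_11_holds` (Bugeaud 2004,
Thm 8.11): in the chart `x_{i₀} ≠ 0`, `|x_{i₀}| = |x|`, approximate `ξ = x_{i₁}/x_{i₀}`
(`|ξ| ≤ 1`) by an algebraic number `α` of degree `≤ ⌊Δ⌋` and Mahler measure `≤ e^H`, take
`K = ℚ(α)` (so `[K:ℚ] = deg α`, `h_K(1 : α) = log M(α)` by `MahlerWeil.weilHeight₁_root_eq`) and
the point `(1 : α)` in that chart; the single minor of `projDist` on `ℂ²` gives
`‖x − σ(1 : α)‖ ≤ |ξ − α|`.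

Sources: NesterenkoPhilippon2001 (LNM 1752) Ch. 4 §4 p. 61 (AP2); Bugeaud2004 Thm 8.11;
LaurentRoy1999; Diaz 1997 (C. R. Acad. Sci. Paris 324).
-/

set_option linter.dupNamespace false

namespace Summit.Schanuel.Schanuel.Cruxes.ApproximationProperty.OrbitInterpolationDeterminant

open Literature.NumberTheory.Transcendental Literature.NumberTheory.Transcendental.Nesterenko
open Polynomial

noncomputable section

/-- On `ℂ²` the projective distance has the single minor `|φ₀ψ₁ − φ₁ψ₀|`: if
`|φ₀ψ₁ − φ₁ψ₀| ≤ B |φ̄| |ψ̄|` (`B ≥ 0`, `φ̄, ψ̄ ≠ 0`) then `‖φ̄ − ψ̄‖ ≤ B`. [folklore] -/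
private theorem projDist_le_of_minor_le {φ ψ : Fin (1 + 1) → ℂ} (hφ : φ ≠ 0) (hψ : ψ ≠ 0)
    {B : ℝ} (hB : 0 ≤ B) (h : ‖φ 0 * ψ 1 - φ 1 * ψ 0‖ ≤ B * (‖φ‖ * ‖ψ‖)) :
    projDist φ ψ ≤ B := by
  have hden : 0 < ‖φ‖ * ‖ψ‖ := mul_pos (norm_pos_iff.mpr hφ) (norm_pos_iff.mpr hψ)
  rw [projDist, div_le_iff₀ hden]
  refine PhilipponMain.sup_minor_le φ ψ (by positivity) fun p => ?_
  obtain ⟨⟨i, k⟩, hik⟩ := p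
  fin_cases i <;> fin_cases k <;> simp at hik
  simpa using h

/-- An irreducible integer polynomial with a complex root has positive degree. [folklore] -/
-- adapted from `Theorems/DiophantineDichotomyApproximationPropertyDegOneLift.lean` (`exists_lift`)
private theorem natDegree_pos_of_aeval_eq_zero {P : ℤ[X]} (hP : Irreducible P) {α : ℂ}
    (hαP : aeval α P = 0) : 0 < P.natDegree := by
  refine Nat.pos_of_ne_zero fun h0 => ?_
  have hc : P = C (P.coeff 0) := Polynomial.eq_C_of_natDegree_eq_zero h0
  have hc0 : P.coeff 0 = 0 := by
    rwa [hc, aeval_C, algebraMap_int_eq, eq_intCast, Int.cast_eq_zero] at hαP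
  rw [hc0, C_0] at hc
  exact hP.ne_zero hc

/-- **The affine core (Diaz's theorem repackaged).** For `|ξ| ≤ 1`, `Δ ≥ 400` and
`H ≥ 400 log(Δ + 1)` there are a number field `K`, `a ∈ K` and `σ : K → ℂ` with `[K:ℚ] ≤ Δ`,
`h_K(a : 1) ≤ H` and `|ξ − σ(a)| ≤ exp(−(Δ h_K(a : 1) + H [K:ℚ])/400)`: Bugeaud 2004 Thm 8.11 at
`n = ⌊Δ⌋`, `M = e^H`, with `K = ℚ(α)`, `[K:ℚ] = deg α ≤ n ≤ Δ` and `h_K(α : 1) = log M(α) ≤ H`.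
[cite: Bugeaud2004, Thm 8.11; NesterenkoPhilippon2001, Ch. 4 §4 p. 61] -/
private theorem exists_numberField_approx {ξ : ℂ} (hξ : ‖ξ‖ ≤ 1) {Δ H : ℝ} (hΔ : 400 ≤ Δ)
    (hH : 400 * Real.log (Δ + 1) ≤ H) :
    ∃ (K : Type) (_ : Field K) (_ : NumberField K) (a : K) (σ : K →+* ℂ),
      (Module.finrank ℚ K : ℝ) ≤ Δ ∧ Height.logHeight ![a, 1] ≤ H ∧
      ‖ξ - σ a‖ ≤
        Real.exp (-((Height.logHeight ![a, 1] * Δ + Module.finrank ℚ K * H) / 400)) := by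
  /- ## numerics of the scale -/
  have hΔ0 : 0 ≤ Δ := by linarith
  have hΔ1 : 0 < Δ + 1 := by linarith
  have hlog1 : 1 ≤ Real.log (Δ + 1) := by
    rw [Real.le_log_iff_exp_le hΔ1]
    have := Real.exp_one_lt_three
    linarith
  have hH400 : 400 ≤ H := by nlinarith
  have hH0 : 0 ≤ H := by linarith
  have hlogH : Real.log (Δ + 1) ≤ H := by nlinarith
  set n : ℕ := ⌊Δ⌋₊ with hn
  have hn50 : 50 ≤ n := Nat.le_floor (by push_cast; linarith)
  have hnΔ : (n : ℝ) ≤ Δ := Nat.floor_le hΔ0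
  have hΔn : Δ ≤ n + 1 := (Nat.lt_floor_add_one Δ).le
  have hnM : (n : ℝ) + 1 ≤ Real.exp H := by
    calc (n : ℝ) + 1 ≤ Δ + 1 := by linarith
      _ = Real.exp (Real.log (Δ + 1)) := (Real.exp_log hΔ1).symm
      _ ≤ Real.exp H := Real.exp_le_exp.mpr hlogH
  have hξM : (4 + ‖ξ‖) ^ 100 ≤ Real.exp H := by
    have h5 : 4 + ‖ξ‖ ≤ Real.exp 2 := by
      have := Real.quadratic_le_exp_of_nonneg (show (0 : ℝ) ≤ 2 by norm_num)
      linarith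
    calc (4 + ‖ξ‖) ^ 100 ≤ Real.exp 2 ^ 100 := pow_le_pow_left₀ (by positivity) h5 100
      _ = Real.exp 200 := by rw [← Real.exp_nat_mul]; norm_num
      _ ≤ Real.exp H := Real.exp_le_exp.mpr (by linarith)
  /- ## Diaz's theorem (Bugeaud 2004, Thm 8.11) at `n = ⌊Δ⌋`, `M = e^H` -/
  obtain ⟨α, P, hPirr, hαP, hPn, hMP, hclose⟩ :=
    Literature.NumberTheory.DiophantineApproximation.Bugeaud2004_thm_8_11_holds ξ n (Real.exp H)
      hn50 hnM hξM
  rw [Real.log_exp] at hclose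
  have hP0 : P ≠ 0 := hPirr.ne_zero
  have hd : 0 < P.natDegree := natDegree_pos_of_aeval_eq_zero hPirr hαP
  set d : ℕ := P.natDegree with hddef
  have hdR : (0 : ℝ) < d := by exact_mod_cast hd
  have hdn : (d : ℝ) ≤ n := by exact_mod_cast hPn
  set L : ℝ := Real.log (P.map (Int.castRingHom ℂ)).mahlerMeasure with hL
  have hMP1 : 1 ≤ (P.map (Int.castRingHom ℂ)).mahlerMeasure :=
    Literature.NumberTheory.DiophantineApproximation.one_le_mahlerMeasure_map P hP0
  have hL0 : 0 ≤ L := Real.log_nonneg hMP1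
  have hLH : L ≤ H := by
    have := Real.log_le_log (by linarith) hMP; rwa [Real.log_exp] at this
  /- ## the number field `K = ℚ(α)` -/
  obtain ⟨hαint, hαdeg⟩ := RoyWaldschmidt1997.natDegree_minpoly_of_irreducible P hPirr hd hαP
  set F : IntermediateField ℚ ℂ := IntermediateField.adjoin ℚ {α} with hF
  haveI : FiniteDimensional ℚ F := IntermediateField.adjoin.finiteDimensional hαint
  haveI : NumberField F := numberField_of_intermediateField F
  have hαF : α ∈ F := IntermediateField.mem_adjoin_simple_self ℚ α
  have hfin : Module.finrank ℚ F = d := by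
    rw [hF, IntermediateField.adjoin.finrank hαint, hαdeg]
  set a : F := ⟨α, hαF⟩ with ha
  -- `h_K(a : 1) = [K:ℚ] h(α) = [K:ℚ] log M(P) / deg P = log M(P)`
  have hheight : Height.logHeight ![a, 1] = L := by
    have hroot := RoyWaldschmidt1997.MahlerWeil.weilHeight₁_root_eq P hPirr hd hαP F hαF
    have hsingle := weilHeight₁_single_eq F hαF
    rw [hsingle, Height.logHeight₁_eq_logHeight, hfin, div_eq_div_iff hdR.ne' hdR.ne'] at hroot
    have := mul_right_cancel₀ hdR.ne' hroot
    rw [← hL] at this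
    exact this
  refine ⟨F, inferInstance, inferInstance, a, (algebraMap F ℂ : F →+* ℂ), ?_, ?_, ?_⟩
  · -- degree budget
    rw [hfin]; exact hdn.trans hnΔ
  · -- height budget
    rw [hheight]; exact hLH
  · -- accuracy
    rw [hheight, hfin]
    have hσa : (algebraMap F ℂ : F →+* ℂ) a = α := rfl
    rw [hσa]
    refine hclose.trans (Real.exp_le_exp.mpr ?_)
    have h1 : 0 ≤ L * (24 * n - 10 * Δ) := mul_nonneg hL0 (by linarith)
    have h2 : 0 ≤ (d : ℝ) * H := by positivity
    rw [neg_le_neg_iff, div_le_iff₀ (by norm_num : (0 : ℝ) < 400)]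
    nlinarith

/-- **Philippon's printed Approximation Property 2 in dimension `n = 1`** (LNM 1752, Ch. 4 §4
p. 61; a theorem in this case: Laurent–Roy 1999, Diaz 1997 = Bugeaud 2004 Thm 8.11): there is
`c ≥ 1` such that for every non-zero `x ∈ ℂ²`, all `Δ ≥ c` and `H ≥ c log(Δ + 1)`, some
`α ∈ K² ∖ 0` over a number field `K` with an embedding `σ : K → ℂ` has `[K:ℚ] ≤ (cΔ)^1`,
`h_K(α) ≤ c^1 H Δ^0` and `‖x − σ(α)‖ ≤ exp(−(Δ h_K(α) + H [K:ℚ])/c)` (projective distance,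
`K`-relative Weil height). Proof: Diaz's theorem in the chart of the largest coordinate of `x`.
[cite: NesterenkoPhilippon2001, Ch. 4 §4 p. 61; Bugeaud2004, Thm 8.11] -/
theorem philipponAP2_one : ∃ c : ℝ, 1 ≤ c ∧ ∀ (x : Fin (1 + 1) → ℂ), x ≠ 0 → ∀ Δ H : ℝ, c ≤ Δ → c * Real.log (Δ + 1) ≤ H → ∃ (K : Type) (_ : Field K) (_ : NumberField K) (α : Fin (1 + 1) → K) (σ : K →+* ℂ), α ≠ 0 ∧ (Module.finrank ℚ K : ℝ) ≤ (c * Δ) ^ 1 ∧ Height.logHeight α ≤ c ^ 1 * H * Δ ^ (1 - 1) ∧ projDist x (fun j => σ (α j)) ≤ Real.exp (-((Height.logHeight α * Δ + Module.finrank ℚ K * H) / c)) := by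
  refine ⟨400, by norm_num, fun x hx Δ H hΔ hH => ?_⟩
  have hΔ0 : 0 ≤ Δ := by linarith
  have hH0 : 0 ≤ H := by
    have : 0 ≤ Real.log (Δ + 1) := Real.log_nonneg (by linarith)
    nlinarith
  have hxpos : 0 < ‖x‖ := norm_pos_iff.mpr hx
  -- the chart: a coordinate of maximal modulus
  obtain ⟨i, hi⟩ := PhilipponMain.exists_norm_eq_norm_apply x
  have hxi : x i ≠ 0 := fun h => by
    rw [h, norm_zero] at hi
    exact hxpos.ne' hi
  obtain rfl | rfl : i = 0 ∨ i = 1 := by fin_cases i <;> decide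
  · /- chart `x₀ ≠ 0`: approximate `ξ = x₁/x₀`, take `α = (1 : a)` -/
    set ξ : ℂ := x 1 / x 0 with hξ
    have hξ1 : ‖ξ‖ ≤ 1 := by
      rw [hξ, norm_div, div_le_one (norm_pos_iff.mpr hxi), ← hi]
      exact norm_le_pi_norm x 1
    obtain ⟨K, _instF, _instNF, a, σ, hd, hh, hdist⟩ := exists_numberField_approx hξ1 hΔ hH
    refine ⟨K, _instF, _instNF, ![1, a], σ, ?_, ?_, ?_, ?_⟩
    · exact fun h => by simpa using congrFun h 0
    · rw [pow_one]; nlinarith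
    · rw [Height.logHeight_swap]
      simp only [pow_one, Nat.sub_self, pow_zero, mul_one]
      nlinarith
    · rw [Height.logHeight_swap]
      refine le_trans ?_ hdist
      have hy0 : (fun j => σ (![(1 : K), a] j)) ≠ 0 := fun h => by simpa using congrFun h 0
      have hy1 : 1 ≤ ‖fun j => σ (![(1 : K), a] j)‖ := by
        have := norm_le_pi_norm (fun j => σ (![(1 : K), a] j)) 0
        simpa using this
      refine projDist_le_of_minor_le hx hy0 (norm_nonneg _) ?_
      have hx1 : x 1 = ξ * x 0 := by rw [hξ, div_mul_cancel₀ _ hxi]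
      have e : x 0 * σ (![(1 : K), a] 1) - x 1 * σ (![(1 : K), a] 0) = -(x 0 * (ξ - σ a)) := by
        simp only [Matrix.cons_val_one, Matrix.cons_val_zero, map_one, hx1]
        ring
      calc ‖x 0 * σ (![(1 : K), a] 1) - x 1 * σ (![(1 : K), a] 0)‖ = ‖x‖ * ‖ξ - σ a‖ * 1 := by
            rw [e, norm_neg, norm_mul, ← hi, mul_one]
        _ ≤ ‖x‖ * ‖ξ - σ a‖ * ‖fun j => σ (![(1 : K), a] j)‖ :=
            mul_le_mul_of_nonneg_left hy1 (by positivity)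
        _ = ‖ξ - σ a‖ * (‖x‖ * ‖fun j => σ (![(1 : K), a] j)‖) := by ring
  · /- chart `x₁ ≠ 0`: approximate `ξ = x₀/x₁`, take `α = (a : 1)` -/
    set ξ : ℂ := x 0 / x 1 with hξ
    have hξ1 : ‖ξ‖ ≤ 1 := by
      rw [hξ, norm_div, div_le_one (norm_pos_iff.mpr hxi), ← hi]
      exact norm_le_pi_norm x 0
    obtain ⟨K, _instF, _instNF, a, σ, hd, hh, hdist⟩ := exists_numberField_approx hξ1 hΔ hH
    refine ⟨K, _instF, _instNF, ![a, 1], σ, ?_, ?_, ?_, ?_⟩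
    · exact fun h => by simpa using congrFun h 1
    · rw [pow_one]; nlinarith
    · simp only [pow_one, Nat.sub_self, pow_zero, mul_one]
      nlinarith
    · refine le_trans ?_ hdist
      have hy0 : (fun j => σ (![a, (1 : K)] j)) ≠ 0 := fun h => by simpa using congrFun h 1
      have hy1 : 1 ≤ ‖fun j => σ (![a, (1 : K)] j)‖ := by
        have := norm_le_pi_norm (fun j => σ (![a, (1 : K)] j)) 1
        simpa using this
      refine projDist_le_of_minor_le hx hy0 (norm_nonneg _) ?_
      have hx0 : x 0 = ξ * x 1 := by rw [hξ, div_mul_cancel₀ _ hxi]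
      have e : x 0 * σ (![a, (1 : K)] 1) - x 1 * σ (![a, (1 : K)] 0) = x 1 * (ξ - σ a) := by
        simp only [Matrix.cons_val_one, Matrix.cons_val_zero, map_one, hx0]
        ring
      calc ‖x 0 * σ (![a, (1 : K)] 1) - x 1 * σ (![a, (1 : K)] 0)‖ = ‖x‖ * ‖ξ - σ a‖ * 1 := by
            rw [e, norm_mul, ← hi, mul_one]
        _ ≤ ‖x‖ * ‖ξ - σ a‖ * ‖fun j => σ (![a, (1 : K)] j)‖ :=
            mul_le_mul_of_nonneg_left hy1 (by positivity)
        _ = ‖ξ - σ a‖ * (‖x‖ * ‖fun j => σ (![a, (1 : K)] j)‖) := by ring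

end

end Summit.Schanuel.Schanuel.Cruxes.ApproximationProperty.OrbitInterpolationDeterminant
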